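import Summits.HodgeConjecture.HodgeConjecture.Theses.MotivatedLefschetzSplit
import Literature.AlgebraicGeometry.HodgeTheory.LefschetzOneOneHolds

/-!
# Route MotivatedLefschetzSplit — `LefschetzOneOneRational` (support item stmt-HodgeConjecture-17936)

The support item is the tree's named fact `lefschetzOneOne_rational` (Lefschetz's theorem on rational
`(1,1)`-classes) by name, DISCHARGED in the tree as `lefschetzOneOne_rational_holds` (Kodaira–Serre
sections, Čech integrality, divisors of meromorphic sections, Chow).  No named-fact hypothesis, no
sorry.
-/

-- `Summit.HodgeConjecture.HodgeConjecture.Theorems` is the mandated namespace (single-problem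
-- summit: Problem = Summit), which `linter.dupNamespace` flags on every declaration; the lakefile
-- turns the linter off tree-wide (weak option), restated here so stand-alone elaboration is
-- warning-free too.
set_option linter.dupNamespace false

namespace Summit.HodgeConjecture.HodgeConjecture.Theorems

/-- **Item stmt-HodgeConjecture-17936 (`LefschetzOneOneRational`), route `MotivatedLefschetzSplit`**:
`lefschetzOneOne_rational_holds`. [cite: VoisinHodgeI2002, Thm. 11.30] -/
theorem motivatedLefschetzSplit_lefschetzOneOneRational_proof :
    Summit.HodgeConjecture.HodgeConjecture.Theses.MotivatedLefschetzSplit.LefschetzOneOneRational :=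
  Literature.AlgebraicGeometry.HodgeTheory.lefschetzOneOne_rational_holds

end Summit.HodgeConjecture.HodgeConjecture.Theorems
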